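import Summits.ResolutionOfSingularities.ResolutionOfSingularities.Theorems.HomologicalConductorNoZenoH0BaseChange
import Summits.ResolutionOfSingularities.ResolutionOfSingularities.Theorems.HomologicalConductorNoZenoExcCurvesUnramifiedBaseChange
import Summits.ResolutionOfSingularities.ResolutionOfSingularities.Theorems.HomologicalConductorNoZenoGaloisAscentNumerics
import Literature.AlgebraicGeometry.Resolution.ExceptionalFibreConnected
import Literature.AlgebraicGeometry.Resolution.BlowupsEquivariant
import Literature.AlgebraicGeometry.Resolution.RegularLocalRingsFlatDescent
import Summits.ResolutionOfSingularities.ResolutionOfSingularities.Theorems.HomologicalConductorNoZenoSpecResidueField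
import HarnessLib

/-!
# Crux `NoZenoR` (stmt-ResolutionOfSingularities-19943), β layer, `stub_L1wCoreF` descent: BC-4b ASSEMBLED —
# GALOIS ASCENT OF MINIMALITY along a flat local base change with transitive symmetry

Route `ResolutionOfSingularities/HomologicalConductor`, crux chain W4.4.  OURS (cell res-hironaka, seat res-L0-w44-stub-2,
(L1)-PREP v4 §2 «proof of record», planner (ρ43e)/(ρ48)); AI-written, weaker than expert review; nothing here is a
statement of the manuscript under review (Hironaka 2017).  Def-free, FACT-PARAMETRIC (`Lipman1969_27_3_rat`,
`Lipman1969_13_1_b_rat`, `Lipman1969_13_1_d_rat` explicit — res-L1-type-o5's F-53/F-97), `--supports 19943 --as helper`.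

SETTING.  `S → Ŝ` a FLAT local homomorphism of two-dimensional normal Noetherian local domains with rational singularities
and `𝔪_S Ŝ = 𝔪_Ŝ` (any finite separable residue extension — e.g. res-D-pv-039's Galois hop `Ŝ = (S[α⃗])_𝔫` of D2″);
`π : X → Spec S` a MINIMAL desingularization, `π_B : X_B → Spec Ŝ` a desingularization sitting in a cartesian square
`σ : X_B → X` over `Spec Ŝ → Spec S`.  Two explicit LOCAL hypotheses, both discharged by the D2″ presentation:
(U) `σ` is unramified at the points over the exceptional curves of `π` (`𝔪_{σ ζ}·𝒪_{X_B,ζ} = 𝔪_ζ`); (T) TRANSITIVE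
SYMMETRY: any two points of `X_B` over the same exceptional generic point `η` of `π` are exchanged by an automorphism of
`X_B` covering an automorphism of `Spec Ŝ` (the stabiliser `H` of `𝔫` acting through `H ↠ Gal(κ̂/κ)`).

* `length_eq_of_semilinearEquiv` — lengths are invariant under semilinear isomorphisms over a ring automorphism;
* `h0_comap_hom_eq` — `h0 π_B (𝓘.comap e.hom) = h0 π_B 𝓘` for an automorphism `e` of `X_B` covering an automorphism of
  `Spec Ŝ`; `comap_hom_primeDivisorIdeal` — `(𝓘_{e ζ}).comap e.hom = 𝓘_ζ`; hence `h0_primeDivisorIdeal_eq_of_iso`,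
  `h0_primeDivisorIdeal_sq_eq_of_iso` — conjugate curves have the same `h⁰(𝓘_ζ)`, `h⁰(𝓘_ζ²)`;
* `mem_excCurvePoints_base_of_mem` — `σ` maps exceptional curves of `π_B` onto exceptional curves of `π`;
* **`isMinimalResolution_of_flat_of_symmetric`** — BC-4b: under (U) and (T), `π_B` is the minimal desingularization
  (`Lipman1969_27_3_rat` on both floors; the numbers are transported by `h0_comap_eq`, `comap_primeDivisorIdeal_eq_prod`,
  `comap_pow`, and distributed over the conjugate components by `three_mul_h0_lt_of_symmetric`).

What is NOT here (the residual of BC-4, ring side + a short scheme wrapper): the discharge of (U), (T) from the D2″ data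
(`H = Stab(𝔫)`, `H ↠ Aut_κ(κ̂)`, res-D-pv-039 F2/F3), and the descent of minimality `Ŝ → S_f`.  References: J. Lipman,
Publ. Math. IHÉS 36 (1969) §27 Cor. (27.3) p. 277, §13 Prop. (13.1) p. 223, §16 (16.1)–(16.5) pp. 231–235
[`Lipman1969`]; B. Conrad, B. Edixhoven, W. Stein, Doc. Math. 8 (2003) Thm. 2.2.2 (the residually-trivial case, context)
[`ConradEdixhovenStein2003`].
-/

noncomputable section

-- single-problem summit: the doubled namespace component `ResolutionOfSingularities` is forced
set_option linter.dupNamespace false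

namespace Summit.ResolutionOfSingularities.ResolutionOfSingularities.Theorems.NoZeno.ExcCount

open CategoryTheory AlgebraicGeometry Limits TopologicalSpace Topology IsLocalRing
open Literature.AlgebraicGeometry.Resolution Literature.AlgebraicGeometry.Morphisms Scheme.IdealSheafData

universe u

/-! ## §1 Lengths under semilinear isomorphisms -/

/-- **Lengths are invariant under semilinear isomorphisms over a ring isomorphism** (the submodule lattices correspond,
Mathlib `Submodule.orderIsoMapComap`). [folklore] -/
theorem length_eq_of_semilinearEquiv {R R₂ : Type*} [CommRing R] [CommRing R₂] {σ : R →+* R₂} {σ' : R₂ →+* R}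
    [RingHomInvPair σ σ'] [RingHomInvPair σ' σ] {M M₂ : Type*} [AddCommGroup M] [Module R M] [AddCommGroup M₂]
    [Module R₂ M₂] (e : M ≃ₛₗ[σ] M₂) : Module.length R M = Module.length R₂ M₂ := by
  apply WithBot.coe_injective
  rw [Module.coe_length, Module.coe_length, Order.krullDim_eq_of_orderIso (Submodule.orderIsoMapComap e)]

/-! ## §2 `h⁰` and prime divisor ideals under automorphisms of `X_B` covering automorphisms of the base -/

section Auto

variable {Ŝ : Type u} [CommRing Ŝ] {XB : Scheme.{u}} (πB : XB ⟶ Spec (.of Ŝ))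
  (e : XB ≅ XB) (θ : Ŝ ≃+* Ŝ) (hcomp : e.hom ≫ πB = πB ≫ Spec.map (CommRingCat.ofHom θ.toRingHom))

include hcomp in
/-- **`h0 π_B (𝓘.comap e.hom) = h0 π_B 𝓘`** for an automorphism `e` of `X_B` covering the automorphism `Spec θ` of the base:
`V(𝓘.comap e.hom) ≅ V(𝓘)` as schemes, and the two `Ŝ`-structures on the global sections differ by the ring automorphism
`θ`, under which lengths are invariant. [folklore] -/
theorem h0_comap_hom_eq (𝓘 : XB.IdealSheafData) : h0 πB (𝓘.comap e.hom) = h0 πB 𝓘 := by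
  rw [h0_eq, h0_eq]
  -- the isomorphism of closed subschemes `φ : V(𝓘.comap e.hom) ≅ V(𝓘)` over `e.hom`
  haveI : IsIso (pullback.snd e.hom 𝓘.subschemeι) := inferInstance
  let φ : (𝓘.comap e.hom).subscheme ≅ 𝓘.subscheme :=
    𝓘.comapIso e.hom ≪≫ asIso (pullback.snd e.hom 𝓘.subschemeι)
  have hφ : φ.hom ≫ 𝓘.subschemeι = (𝓘.comap e.hom).subschemeι ≫ e.hom := by
    change (_ ≫ pullback.snd e.hom 𝓘.subschemeι) ≫ _ = _
    rw [Category.assoc, ← pullback.condition, ← Category.assoc, Scheme.IdealSheafData.comapIso_hom_fst]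
  -- the induced ring isomorphism of global sections
  haveI : IsIso (φ.hom.app ⊤) := inferInstance
  let ψ : Sections (𝓘.subschemeι ≫ πB) ⊤ ≃+* Sections ((𝓘.comap e.hom).subschemeι ≫ πB) ⊤ :=
    (asIso (φ.hom.app ⊤)).commRingCatIsoToRingEquiv
  -- the `Ŝ`-structures: `algebraMap = algebraMapΓ` (the restriction `⊤ ≤ ⊤` is the identity)
  have halg : ∀ (Y : Scheme.{u}) (f : Y ⟶ Spec (.of Ŝ)) (s : Ŝ),
      algebraMap Ŝ (Sections f ⊤) s = f.appTop ((Scheme.ΓSpecIso (.of Ŝ)).inv s) := by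
    intro Y f s
    rw [Sections.algebraMap_apply]
    have hid : (homOfLE (le_top : (⊤ : Y.Opens) ≤ ⊤)).op = 𝟙 _ := Subsingleton.elim _ _
    rw [hid, Y.presheaf.map_id]
    rfl
  -- it is `θ`-semilinear for the two `Ŝ`-structures
  have hsemi : ∀ (s : Ŝ) (x : Sections (𝓘.subschemeι ≫ πB) ⊤),
      ψ (s • x) = θ s • ψ x := by
    intro s x
    rw [Algebra.smul_def, Algebra.smul_def, map_mul]
    congr 1
    rw [halg, halg]
    change (φ.hom.app ⊤) ((𝓘.subschemeι ≫ πB).appTop ((Scheme.ΓSpecIso (.of Ŝ)).inv s)) =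
      ((𝓘.comap e.hom).subschemeι ≫ πB).appTop ((Scheme.ΓSpecIso (.of Ŝ)).inv (θ s))
    have h2 : φ.hom ≫ 𝓘.subschemeι ≫ πB =
        ((𝓘.comap e.hom).subschemeι ≫ πB) ≫ Spec.map (CommRingCat.ofHom θ.toRingHom) := by
      rw [← Category.assoc, hφ, Category.assoc, hcomp, Category.assoc]
    have l1 : (φ.hom ≫ 𝓘.subschemeι ≫ πB).appTop ((Scheme.ΓSpecIso (.of Ŝ)).inv s) =
        (φ.hom.app ⊤) ((𝓘.subschemeι ≫ πB).appTop ((Scheme.ΓSpecIso (.of Ŝ)).inv s)) := by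
      rw [Scheme.Hom.comp_appTop]; rfl
    have l2 : (((𝓘.comap e.hom).subschemeι ≫ πB) ≫ Spec.map (CommRingCat.ofHom θ.toRingHom)).appTop
          ((Scheme.ΓSpecIso (.of Ŝ)).inv s) =
        ((𝓘.comap e.hom).subschemeι ≫ πB).appTop
          ((Spec.map (CommRingCat.ofHom θ.toRingHom)).appTop ((Scheme.ΓSpecIso (.of Ŝ)).inv s)) := by
      rw [Scheme.Hom.comp_appTop]; rfl
    rw [← l1, h2, l2]
    congr 1
    have hnat := Scheme.ΓSpecIso_inv_naturality (CommRingCat.ofHom θ.toRingHom)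
    change ((Scheme.ΓSpecIso (.of Ŝ)).inv ≫ (Spec.map (CommRingCat.ofHom θ.toRingHom)).appTop) s =
      (Scheme.ΓSpecIso (.of Ŝ)).inv (θ s)
    rw [← hnat]
    rfl
  letI : RingHomInvPair θ.toRingHom θ.symm.toRingHom := RingHomInvPair.of_ringEquiv θ
  letI : RingHomInvPair θ.symm.toRingHom θ.toRingHom := RingHomInvPair.symm _ _
  let ψₗ : Sections (𝓘.subschemeι ≫ πB) ⊤ ≃ₛₗ[θ.toRingHom] Sections ((𝓘.comap e.hom).subschemeι ≫ πB) ⊤ :=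
    { ψ with map_smul' := fun s x => hsemi s x }
  exact (length_eq_of_semilinearEquiv ψₗ).symm

/-- **`(𝓘_{e ζ}).comap e.hom = 𝓘_ζ`**: an automorphism pulls back the prime divisor ideal of `e ζ` to that of `ζ`
(tree `vanishingIdeal_comap_hom`). [folklore] -/
theorem comap_hom_primeDivisorIdeal (ζ : XB) : (primeDivisorIdeal (e.hom.base ζ)).comap e.hom = primeDivisorIdeal ζ := by
  rw [primeDivisorIdeal, vanishingIdeal_comap_hom]
  unfold primeDivisorIdeal
  congr 1
  apply TopologicalSpace.Closeds.ext
  change (Scheme.homeoOfIso e) ⁻¹' closure {(Scheme.homeoOfIso e) ζ} = closure {ζ}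
  rw [(Scheme.homeoOfIso e).preimage_closure, ← Set.image_singleton,
    (Scheme.homeoOfIso e).injective.preimage_image]

include hcomp in
/-- **Conjugate curves have the same `h⁰`**: `h0 π_B 𝓘_{e ζ} = h0 π_B 𝓘_ζ`. [folklore] -/
theorem h0_primeDivisorIdeal_eq_of_iso (ζ : XB) :
    h0 πB (primeDivisorIdeal (e.hom.base ζ)) = h0 πB (primeDivisorIdeal ζ) := by
  rw [← h0_comap_hom_eq πB e θ hcomp (primeDivisorIdeal (e.hom.base ζ)), comap_hom_primeDivisorIdeal]

include hcomp in
/-- **Conjugate curves have the same `h⁰(𝓘²)`**: `h0 π_B 𝓘_{e ζ}² = h0 π_B 𝓘_ζ²`. [folklore] -/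
theorem h0_primeDivisorIdeal_sq_eq_of_iso (ζ : XB) :
    h0 πB (primeDivisorIdeal (e.hom.base ζ) ^ 2) = h0 πB (primeDivisorIdeal ζ ^ 2) := by
  rw [← h0_comap_hom_eq πB e θ hcomp (primeDivisorIdeal (e.hom.base ζ) ^ 2), comap_pow,
    comap_hom_primeDivisorIdeal]

end Auto

/-! ## §3 BC-4b: Galois ascent of minimality -/

section Ascent

variable {S Ŝ : Type u} [CommRing S] [IsNoetherianRing S] [IsLocalRing S] [IsDomain S] [IsIntegrallyClosed S]
  [CommRing Ŝ] [IsNoetherianRing Ŝ] [IsLocalRing Ŝ] [IsDomain Ŝ] [IsIntegrallyClosed Ŝ]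
  [Algebra S Ŝ] [IsLocalHom (algebraMap S Ŝ)] [Module.Flat S Ŝ]
  {X XB : Scheme.{u}} (π : X ⟶ Spec (.of S)) (πB : XB ⟶ Spec (.of Ŝ)) (σ : XB ⟶ X)
  (H : IsPullback σ πB π (Spec.map (CommRingCat.ofHom (algebraMap S Ŝ))))

omit [IsNoetherianRing S] [IsLocalRing S] [IsDomain S] [IsIntegrallyClosed S] [IsNoetherianRing Ŝ] [IsLocalRing Ŝ]
  [IsDomain Ŝ] [IsIntegrallyClosed Ŝ] [IsLocalHom (algebraMap S Ŝ)] in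
include H in
/-- `σ` is flat (base change of the flat `Spec Ŝ → Spec S`). [folklore] -/
theorem flat_of_isPullback : Flat σ := by
  haveI : Flat (Spec.map (CommRingCat.ofHom (algebraMap S Ŝ))) := by
    rw [HasRingHomProperty.Spec_iff (P := @Flat)]
    exact RingHom.flat_algebraMap_iff.mpr inferInstance
  exact MorphismProperty.of_isPullback H.flip inferInstance

omit [IsNoetherianRing S] [IsDomain S] [IsIntegrallyClosed S] [IsNoetherianRing Ŝ] [IsDomain Ŝ] [IsIntegrallyClosed Ŝ]
  [Module.Flat S Ŝ] in
include H in
/-- Points of `X_B` over the closed point of `Ŝ` map to points of `X` over the closed point of `S`. [folklore] -/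
theorem base_eq_closedPoint_of_base_eq {ζ : XB} (hζ : πB.base ζ = closedPoint Ŝ) : π.base (σ.base ζ) = closedPoint S := by
  have h := congrArg (fun f => f.base ζ) H.w
  simp only [Scheme.Hom.comp_base, TopCat.coe_comp, Function.comp_apply] at h
  rw [h, hζ]
  exact specMap_closedPoint S Ŝ

omit [IsIntegrallyClosed Ŝ] in
include H in
/-- **`σ` maps exceptional curves of `π_B` to exceptional curves of `π`**: for `ζ ∈ excCurvePoints π_B`, `σ ζ ∈ excCurvePoints π`
(`σ ζ` lies over the closed point, has codimension `≤ 1` by flatness and is not the generic point). [folklore] -/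
theorem mem_excCurvePoints_base_of_mem (h2 : ringKrullDim S = 2) (h2B : ringKrullDim Ŝ = 2) (hπ : IsResolution π)
    (hπB : IsResolution πB) (hsing : ¬ IsRegularLocalRing S) {ζ : XB} (hζ : ζ ∈ excCurvePoints πB) :
    σ.base ζ ∈ excCurvePoints π := by
  haveI : Flat σ := flat_of_isPullback π πB σ H
  haveI : IsIntegral X := hπ.isIntegral_source
  haveI : IsIntegral XB := hπB.isIntegral_source
  haveI : IsProper π := hπ.isProper
  haveI : IsProper πB := hπB.isProper
  haveI : IsLocallyNoetherian X := LocallyOfFiniteType.isLocallyNoetherian π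
  haveI : IsLocallyNoetherian XB := LocallyOfFiniteType.isLocallyNoetherian πB
  have hbase : π.base (σ.base ζ) = closedPoint S := base_eq_closedPoint_of_base_eq π πB σ H hζ.1
  refine hπ.mem_excCurvePoints_of_coheight_eq_one h2 hsing hbase (le_antisymm ?_ ?_)
  · -- `coheight (σ ζ) ≤ coheight ζ = 1` along the flat `σ`
    have h := coheight_base_le_of_flat σ ζ
    rwa [hπB.coheight_eq_one_of_mem_excCurvePoints h2B hζ] at h
  · -- `σ ζ` is not the generic point: it lies over the closed point of the two-dimensional `S`
    refine Order.one_le_iff_ne_zero.mpr fun h0 => ?_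
    have hgen : σ.base ζ = genericPoint X := eq_genericPoint_of_coheight_eq_zero h0
    haveI : IsDominant π := hπ.isBirational.isDominant
    have hπgen : π.base (genericPoint X) = genericPoint (Spec (.of S)) :=
      Literature.AlgebraicGeometry.Motives.RatFn.genericPoint_eq_of_isDominant π
    rw [hgen, hπgen, genericPoint_eq_bot_of_affine] at hbase
    have hm : maximalIdeal S = ⊥ := by
      have := (congrArg PrimeSpectrum.asIdeal hbase).symm
      change maximalIdeal S = (⊥ : PrimeSpectrum S).asIdeal at this
      simpa using this
    have hh := IsLocalRing.maximalIdeal_height_eq_ringKrullDim (R := S)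
    rw [hm, Ideal.height_bot, h2] at hh
    exact absurd hh (by decide)

include H in
/-- **BC-4b — GALOIS ASCENT OF MINIMALITY.**  Let `S → Ŝ` be a flat local homomorphism of two-dimensional normal Noetherian
local domains with rational singularities and `𝔪_S·Ŝ = 𝔪_Ŝ`, `π : X → Spec S` a MINIMAL desingularization of the (singular)
`S`, and `π_B : X_B → Spec Ŝ` a desingularization with `X_B = X ×_{Spec S} Spec Ŝ` (`σ : X_B → X`).  Assume (U): `σ` is
unramified at every point over an exceptional generic point of `π`, and (T): any two points of `X_B` over the same
exceptional generic point of `π` are conjugate under an automorphism of `X_B` covering an automorphism of `Spec Ŝ`.  Then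
`π_B` is the MINIMAL desingularization of `Spec Ŝ`.  Proof: by `Lipman1969_27_3_rat` it suffices that every integral
exceptional curve `C_ζ` of `π_B` satisfy `3·h⁰(𝓘_ζ) < h⁰(𝓘_ζ²)`; with `η = σ ζ`, `Ê := σ*𝓘_η = ∏_{ζ' ↦ η} 𝓘_{ζ'}`
(`comap_primeDivisorIdeal_eq_prod`) has `h⁰(Ê) = h⁰(𝓘_η)`, `h⁰(Ê²) = h⁰(𝓘_η²)` (`h0_comap_eq`, `comap_pow`), so (M) for
`E_η` downstairs (minimality of `π`, (27.3)) is (M) for `Ê`, which the symmetric numerics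
(`three_mul_h0_lt_of_symmetric`, (13.1) b), d)) distribute to `C_ζ`. [cite: Lipman1969, Corollary (27.3) (p. 277) and Proposition (13.1) (p. 223)] -/
theorem isMinimalResolution_of_flat_of_symmetric
    (h273 : Lipman1969_27_3_rat.{u}) (h131b : Lipman1969_13_1_b_rat.{u}) (h131d : Lipman1969_13_1_d_rat.{u})
    (h2 : ringKrullDim S = 2) (h2B : ringKrullDim Ŝ = 2) (hS : HasRationalSingularity S)
    (hSB : HasRationalSingularity Ŝ) (hsing : ¬ IsRegularLocalRing S)
    (hmax : (maximalIdeal S).map (algebraMap S Ŝ) = maximalIdeal Ŝ)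
    (hπ : IsMinimalResolution π) (hπB : IsResolution πB)
    (hunr : ∀ ζ : XB, σ.base ζ ∈ excCurvePoints π →
      (maximalIdeal (X.presheaf.stalk (σ.base ζ))).map (σ.stalkMap ζ).hom = maximalIdeal (XB.presheaf.stalk ζ))
    (hsymm : ∀ ζ ζ' : XB, σ.base ζ ∈ excCurvePoints π → σ.base ζ' = σ.base ζ →
      ∃ (e : XB ≅ XB) (θ : Ŝ ≃+* Ŝ), e.hom ≫ πB = πB ≫ Spec.map (CommRingCat.ofHom θ.toRingHom) ∧ e.hom.base ζ = ζ') :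
    IsMinimalResolution πB := by
  classical
  haveI : Flat σ := flat_of_isPullback π πB σ H
  haveI : IsIntegral X := hπ.1.isIntegral_source
  haveI : IsIntegral XB := hπB.isIntegral_source
  haveI : IsProper π := hπ.1.isProper
  haveI : IsProper πB := hπB.isProper
  haveI : IsLocallyNoetherian X := LocallyOfFiniteType.isLocallyNoetherian π
  haveI : IsLocallyNoetherian XB := LocallyOfFiniteType.isLocallyNoetherian πB
  haveI : CompactSpace X := QuasiCompact.compactSpace_of_compactSpace π
  haveI : CompactSpace XB := QuasiCompact.compactSpace_of_compactSpace πB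
  haveI : IsNoetherian X := {}
  haveI : IsNoetherian XB := {}
  have hX : Scheme.IsRegular X := hπ.1.isRegular
  have hXB : Scheme.IsRegular XB := hπB.isRegular
  -- (27.3) upstairs: it suffices to check (M) for every integral exceptional curve of `π_B`
  refine (h273 Ŝ h2B hSB XB πB hπB).mpr fun ζ hζ => ?_
  -- the curve downstairs
  set η := σ.base ζ with hηdef
  have hη : η ∈ excCurvePoints π := mem_excCurvePoints_base_of_mem π πB σ H h2 h2B hπ.1 hπB hsing hζ
  have hcoη : Order.coheight η = 1 := hπ.1.coheight_eq_one_of_mem_excCurvePoints h2 hη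
  -- (M) downstairs, from the minimality of `π`
  have hM : 3 * h0 π (primeDivisorIdeal η) < h0 π (primeDivisorIdeal η ^ 2) := (h273 S h2 hS X π hπ.1).mp hπ η hη
  -- the reduced pulled-back curve `Ê = σ*𝓘_η = ∏_{ζ' ↦ η} 𝓘_{ζ'}`
  have hunr' : ∀ ζ' : XB, σ.base ζ' = η →
      (maximalIdeal (X.presheaf.stalk (σ.base ζ'))).map (σ.stalkMap ζ').hom = maximalIdeal (XB.presheaf.stalk ζ') :=
    fun ζ' h' => hunr ζ' (h' ▸ hη)
  have hne : (primeDivisorIdeal η).comap σ ≠ ⊥ :=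
    comap_primeDivisorIdeal_ne_bot σ rfl (hπB.coheight_eq_one_of_mem_excCurvePoints h2B hζ) (hunr' ζ rfl)
  have hfin : (σ.base ⁻¹' {η}).Finite := by
    rw [← divisorialPoints_comap_primeDivisorIdeal σ hcoη hunr']
    exact finite_divisorialPoints hne
  have hprod := comap_primeDivisorIdeal_eq_prod σ hcoη hX hXB hunr' hne hfin
  -- its numbers are those of `E_η`
  have h0P : h0 πB (∏ ζ' ∈ hfin.toFinset, primeDivisorIdeal ζ') = h0 π (primeDivisorIdeal η) := by
    rw [← hprod]; exact h0_comap_eq π πB σ H (primeDivisorIdeal η) hmax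
  have h0P2 : h0 πB ((∏ ζ' ∈ hfin.toFinset, primeDivisorIdeal ζ') ^ 2) = h0 π (primeDivisorIdeal η ^ 2) := by
    rw [← hprod, ← comap_pow]; exact h0_comap_eq π πB σ H (primeDivisorIdeal η ^ 2) hmax
  have hMB : 3 * h0 πB (∏ ζ' ∈ hfin.toFinset, primeDivisorIdeal ζ') <
      h0 πB ((∏ ζ' ∈ hfin.toFinset, primeDivisorIdeal ζ') ^ 2) := by
    rw [h0P, h0P2]; exact hM
  -- the components are exceptional curves of `π_B`
  have hζF : ζ ∈ hfin.toFinset := by simp [hηdef]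
  have hFe : ∀ ζ' ∈ hfin.toFinset, ζ' ∈ excCurvePoints πB := by
    intro ζ' hζ'
    have hζ'η : σ.base ζ' = η := by simpa using hζ'
    have hco : Order.coheight ζ' = 1 := coheight_eq_one_of_map_maximalIdeal_eq σ hcoη hζ'η (hunr' ζ' hζ'η)
    -- `ζ'` lies over the closed point of `Ŝ` (the only point of `Spec Ŝ` over the closed point of `S`)
    have hbase : πB.base ζ' = closedPoint Ŝ := by
      have hw := congrArg (fun f => f.base ζ') H.w
      simp only [Scheme.Hom.comp_base, TopCat.coe_comp, Function.comp_apply] at hw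
      rw [hζ'η, hη.1] at hw
      have hmem : πB.base ζ' ∈ (Spec.map (CommRingCat.ofHom (algebraMap S Ŝ))).base ⁻¹' {closedPoint S} :=
        hw.symm
      rw [preimage_closedPoint_eq_of_map_maximalIdeal S Ŝ hmax] at hmem
      exact hmem
    exact hπB.mem_excCurvePoints_of_coheight_eq_one h2B
      (fun hreg => hsing (by
        haveI := hreg
        exact IsRegularLocalRing.of_flat_of_isLocalHom S Ŝ)) hbase hco
  -- symmetry: all components have the same numbers as `ζ`
  have ha : ∀ ζ' ∈ hfin.toFinset, h0 πB (primeDivisorIdeal ζ') = h0 πB (primeDivisorIdeal ζ) := by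
    intro ζ' hζ'
    have hζ'η : σ.base ζ' = η := by simpa using hζ'
    obtain ⟨e, θ, hcomp, heζ⟩ := hsymm ζ ζ' hη hζ'η
    rw [← heζ, h0_primeDivisorIdeal_eq_of_iso πB e θ hcomp]
  have hb : ∀ ζ' ∈ hfin.toFinset, h0 πB (primeDivisorIdeal ζ' ^ 2) = h0 πB (primeDivisorIdeal ζ ^ 2) := by
    intro ζ' hζ'
    have hζ'η : σ.base ζ' = η := by simpa using hζ'
    obtain ⟨e, θ, hcomp, heζ⟩ := hsymm ζ ζ' hη hζ'η
    rw [← heζ, h0_primeDivisorIdeal_sq_eq_of_iso πB e θ hcomp]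
  exact three_mul_h0_lt_of_symmetric πB h2B hSB hπB h131b h131d hfin.toFinset hFe hζF ha hb hMB

end Ascent

end Summit.ResolutionOfSingularities.ResolutionOfSingularities.Theorems.NoZeno.ExcCount

end
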